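import Mathlib
import HarnessLib

/-!
# Bernstein–Szegő orthogonality and the finite sections of the shift

Topic `Analysis/Toeplitz`, namespace `Literature.Analysis.Toeplitz`, construction objects in the
sub-namespace `BernsteinSzego`.

**Source.** G. Szegő, *Orthogonal Polynomials*, AMS Colloquium Publications 23 [Szego1939],
§11.2 "Example", Theorem 11.2, eq. (11.2.2) (the **Bernstein–Szegő weights**): if
`f(θ) = 1/g(θ)` with `g = |h(e^{iθ})|²` a positive trigonometric polynomial of degree `m` in its
normalised (Fejér–Riesz) representation (`h` a polynomial of precise degree `m`, `h(0) > 0`, no zeros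
in `|z| ≤ 1`, Thm 1.2.2), then the orthonormal polynomials of `f` are
`φ_n(z) = z^{n-m} h^*(z)` for every `n ≥ m`, `h^*(z) = z^m \overline{h}(z^{-1})` — proved at the
page by Cauchy's theorem ("let `ρ` be an arbitrary `π_{n-1}` …
`(2πi)^{-1} ∫_{|z|=1} z^{n-1} \overline{ρ}(z^{-1}) / h(z) dz = 0`") together with
`(2π)^{-1}∫ f |φ_n|² dθ = 1`.

**What is formalised here (all proved, no named facts).** The *finite-section consequences* of
that orthogonality, at the level of an abstract inner-product space `E` over `𝕜 = ℝ` or `ℂ`, a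
linear operator `U` (in the model: multiplication by `z` on `L²(𝕋, f dθ/2π)`), a vector `e` (the
constant `1`) with linearly independent orbit `U^k e` (the monomials), and a list of scalars
`r : Fin σ → 𝕜` (the zeros of `h^*`, i.e. the reflected zeros `1/\bar α` of `h`): with
`ψ := ∏_{i<σ}(U - r_i) e` (`= h^*(M_z) 1 / \overline{h(0)}` in the model) the structure
`IsBernsteinSzego U e r` records exactly Szegő's conclusion "`U^j ψ ⊥ U^m e` for `m < j + σ`"
(= `φ_{j+σ} ∝ z^j h^*`). From it:

* `IsBernsteinSzego.newtonBasis` — the *Newton basis* `β_k = ∏_{i<k}(U - r̃_i) e` of the Krylov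
  space `H_n = span{e, …, Uⁿe}` (`= 𝒫_n`), `r̃ = (r_0, …, r_{σ-1}, 0, 0, …)`, in which the
  compressed shift `Q_n U|_{H_n}` (`Q_n` = orthogonal projection onto `H_n`) is **lower
  bidiagonal** with diagonal `r̃_0, …, r̃_n` as soon as `σ ≤ n + 1`
  (`IsBernsteinSzego.compShift_one_newtonFamily`, `IsBernsteinSzego.toMatrix_compShift_one`);
* **`IsBernsteinSzego.trace_compShift`** — for `σ ≤ n + 1` and `l ≥ 1`,
  `Tr(Q_n U^l Q_n) = ∑_{i<σ} r_i^l` (power sums of the prescribed roots), *independent of `n`*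
  (`IsBernsteinSzego.trace_compShift_eq`), while `Tr(Q_n) = n + 1`
  (`IsBernsteinSzego.trace_compShift_zero`);
* **`IsBernsteinSzego.compShift_one_pow`** — the power identity `(Q_n U Q_n)^l = Q_n U^l Q_n`
  for `σ ≤ n + 1` (because `U` maps `H_{n+l} ⊖ H_n = span{β_{n+1}, …}` into `H_n^⊥`,
  `IsBernsteinSzego.orthogonalProjectionOnto_apply_sub_starProjection`);
* `trace_pow_of_lowerTriangular` — trace of a power of a lower-triangular matrix;
* the arithmetic of the number-theoretic instance: `sum_pow_rootOfUnity_mul`,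
  `sum_sum_pow_roots_eq` (power sums of the roots `ζ_{d_v}^j c` of `∏_v (X^{d_v} - c^{d_v})` are
  `c^l ∑_{v : d_v ∣ l} d_v`) and `prod_X_pow_sub_C_pow_eq_prod_prod`.

**Why (the reading this file was written for; context, not used in any proof).** In A. Connes,
Selecta Math. 5 (1999) [Connes1999] §VIII, the semilocal cutoff system on the function field
`𝔽_q(T)` at a finite set of places `S` (degrees `d_v`) — vectors `η_m`, cutoff space `B_Λ`
(`Λ = q^N`, `dim B_Λ = 2N + 3` in the trivial-character sector) and the scaled shift
`V = q^{1/2} U(g_1)` — has Gram matrix the Toeplitz matrix of the weight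
`|ζ_S(½ + it)|² = 1/|p_S(e^{iθ})|²`, `p_S(z) = ∏_{v∈S}(1 - (z/√q)^{d_v})`, a Bernstein–Szegő weight of
degree `σ = deg S = ∑_v d_v` (dictionary `η'_m ↦ z^m`; this identification is a computation on
Connes' formulas VIII (5)–(14) recorded in the hub's construction census, not formalised here).
With `r` = the zeros `ζ q^{-1/2}` (`ζ^{d_v} = 1`) of `p_S^*(z) = ∏_v (z^{d_v} - q^{-d_v/2})` the
theorems above say: *for `2N + 3 ≥ deg S` the finite-level traces `Tr(Q_Λ V^l Q_Λ)`, `l ≠ 0`, equal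
`q^{-|l|/2} ∑_{v∈S, d_v ∣ l} d_v` exactly and independently of `Λ`, `Tr Q_Λ = 2N + 3`, and
`(Q_Λ V Q_Λ)^l = Q_Λ V^l Q_Λ`* — Connes' exact semilocal trace formula in positive characteristic
[Connes1999, §VIII Lemma 1, Cor. 2] seen as a Bernstein–Szegő phenomenon (above the threshold the
`l ≠ 0` Fourier coefficients of `f K_n` are those of `-2 Re (z h'/h)`, cf. [Szego1939] Thm 11.4.2).

**Not formalised (stated honestly).** (i) The verification of `IsBernsteinSzego` for the concrete
space `L²(𝕋, dθ/(2π|h|²))` (Szegő's Cauchy-theorem argument quoted above) — the structure is the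
interface a model must supply; (ii) the converse "below the threshold (`n + 1 < σ`) some `l ≠ 0`
trace differs from the power sum"; (iii) the Christoffel–Darboux evaluation `f K_σ = σ - 2Re(zh'/h)`
itself (only its consequence for traces is proved, via the Newton basis rather than via
[Szego1939] Thm 11.4.2); (iv) anything about Connes' adelic spaces. TODO(model): the `ℓ²(ℕ)`
unilateral-shift model with `e` = Taylor coefficients of `1/h`, where `IsBernsteinSzego` reduces to
the convolution identity `h · (1/h) = 1`.

## References

* [Szego1939] G. Szegő, *Orthogonal Polynomials*, AMS Colloq. Publ. 23 (1939; 4th ed. 1975),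
  §11.2 Theorem 11.2 eq. (11.2.2); §11.4 Theorem 11.4.2; Theorem 1.2.2.
* [Connes1999] A. Connes, *Trace formula in noncommutative geometry and the zeros of the Riemann
  zeta function*, Selecta Math. (N.S.) 5 (1999) 29–106, §VIII (eqs. (5)–(14), Lemma 1, Cor. 2).
-/

noncomputable section

open scoped InnerProductSpace
open Submodule Module Polynomial

namespace Literature.Analysis.Toeplitz

namespace BernsteinSzego

variable {𝕜 : Type*} [RCLike 𝕜] {E : Type*} [NormedAddCommGroup E] [InnerProductSpace 𝕜 E]

/-- The Krylov (cyclic) subspace `H_n = span {e, U e, …, Uⁿ e}` of the operator `U` and the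
vector `e`. In the Bernstein–Szegő model (`U` = multiplication by `z` on `L²(𝕋, f dθ/2π)`,
`e = 1`) this is the space `𝒫_n` of polynomials of degree `≤ n`. [folklore] -/
def krylov (U : E →ₗ[𝕜] E) (e : E) (n : ℕ) : Submodule 𝕜 E :=
  span 𝕜 (Set.range fun i : Fin (n + 1) => (U ^ (i : ℕ)) e)

/-- `H_n` is finite-dimensional (spanned by `n + 1` vectors). [folklore] -/
instance krylov.finiteDimensional (U : E →ₗ[𝕜] E) (e : E) (n : ℕ) :
    FiniteDimensional 𝕜 (krylov U e n) :=
  FiniteDimensional.span_of_finite 𝕜 (Set.finite_range _)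

/-- `H_n` is complete (finite-dimensional), hence admits an orthogonal projection. [folklore] -/
instance krylov.completeSpace (U : E →ₗ[𝕜] E) (e : E) (n : ℕ) :
    CompleteSpace (krylov U e n) :=
  FiniteDimensional.complete 𝕜 _

/-- The sequence of prescribed "roots" extended by zero: `rootSeq r i = r i` for `i < σ` and `0`
for `i ≥ σ`. [folklore] -/
def rootSeq {σ : ℕ} (r : Fin σ → 𝕜) (i : ℕ) : 𝕜 :=
  if h : i < σ then r ⟨i, h⟩ else 0

/-- `rootSeq r i = r i` below `σ`. [folklore] -/
private theorem rootSeq_of_lt {σ : ℕ} (r : Fin σ → 𝕜) {i : ℕ} (h : i < σ) : rootSeq r i = r ⟨i, h⟩ :=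
  dif_pos h

/-- `rootSeq r i = 0` from `σ` on. [folklore] -/
private theorem rootSeq_of_le {σ : ℕ} (r : Fin σ → 𝕜) {i : ℕ} (h : σ ≤ i) : rootSeq r i = 0 :=
  dif_neg (not_lt.mpr h)

/-- The Newton vectors `β_k = ∏_{i<k} (U - rootSeq r i) e`: `β_0 = e`,
`β_{k+1} = U β_k - (rootSeq r k) β_k`. For `k ≤ σ` these are `∏_{i<k}(U - r_i) e`; for `k ≥ σ`
they are `U^{k-σ} ψ` with `ψ = β_σ = ∏_{i<σ}(U - r_i) e` (`newtonVec_eq_pow_apply`). [folklore] -/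
def newtonVec (U : E →ₗ[𝕜] E) (e : E) {σ : ℕ} (r : Fin σ → 𝕜) : ℕ → E
  | 0 => e
  | k + 1 => U (newtonVec U e r k) - rootSeq r k • newtonVec U e r k

section basic

variable (U : E →ₗ[𝕜] E) (e : E) {σ : ℕ} (r : Fin σ → 𝕜)

/-- `β_0 = e`. [folklore] -/
@[simp] private theorem newtonVec_zero : newtonVec U e r 0 = e := rfl

/-- `β_{k+1} = U β_k - r_k β_k` (definition). [folklore] -/
private theorem newtonVec_succ (k : ℕ) :
    newtonVec U e r (k + 1) = U (newtonVec U e r k) - rootSeq r k • newtonVec U e r k := rfl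

/-- The shift recurrence `U β_k = β_{k+1} + r_k β_k`. (The three-term structure behind Szegő's recurrence (11.4.7) in the Bernstein–Szegő range.) [cite: Szego1939, Thm 11.4.2, eq. (11.4.7)] -/
theorem apply_newtonVec (k : ℕ) :
    U (newtonVec U e r k) = newtonVec U e r (k + 1) + rootSeq r k • newtonVec U e r k := by
  rw [newtonVec_succ, sub_add_cancel]

/-- `β_k = (∏_{i<k} (X - C (rootSeq r i)))(U) e`; in particular `β_{σ+j} = U^j ∏_{i<σ}(U - r_i) e`, the
abstract form of Szegő's `φ_{m+j}(z) = z^{j} h^*(z)` (in the model `∏_{i<σ}(X - r_i) = h^*/\overline{h(0)}`).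
[cite: Szego1939, §11.2 Thm 11.2, eq. (11.2.2)] -/
theorem newtonVec_eq_aeval (k : ℕ) :
    newtonVec U e r k =
      aeval U (∏ i ∈ Finset.range k, (X - C (rootSeq r i))) e := by
  induction k with
  | zero => simp
  | succ k ih =>
    rw [Finset.prod_range_succ_comm, map_mul, Module.End.mul_apply, ← ih, newtonVec_succ,
      map_sub, aeval_X, aeval_C, LinearMap.sub_apply, Module.algebraMap_end_apply]

/-- Above `σ` the recurrence is the plain shift: `β_k = U^{k-σ} β_σ` for `σ ≤ k`. [cite: Szego1939, §11.2 Thm 11.2, eq. (11.2.2)] -/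
theorem newtonVec_eq_pow_apply {k : ℕ} (hk : σ ≤ k) :
    newtonVec U e r k = (U ^ (k - σ)) (newtonVec U e r σ) := by
  obtain ⟨j, rfl⟩ := Nat.exists_eq_add_of_le hk
  rw [Nat.add_sub_cancel_left]
  clear hk
  induction j with
  | zero => simp
  | succ j ih =>
    rw [← Nat.add_assoc, newtonVec_succ, rootSeq_of_le r (Nat.le_add_right σ j), zero_smul,
      sub_zero, ih, pow_succ', Module.End.mul_apply]

/-! ### Span bookkeeping: `H_n = span {β_0, …, β_n}` -/

/-- `U^i e ∈ H_n` for `i ≤ n`. [folklore] -/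
private theorem pow_apply_mem_krylov {i n : ℕ} (h : i ≤ n) : (U ^ i) e ∈ krylov U e n :=
  subset_span ⟨⟨i, Nat.lt_succ_of_le h⟩, rfl⟩

/-- `H_m ≤ H_n` for `m ≤ n`. [folklore] -/
private theorem krylov_mono {m n : ℕ} (h : m ≤ n) : krylov U e m ≤ krylov U e n := by
  refine span_le.mpr ?_
  rintro _ ⟨i, rfl⟩
  exact pow_apply_mem_krylov U e (Nat.le_trans (Nat.le_of_lt_succ i.2) h)

/-- `U H_n ⊆ H_{n+1}`. [folklore] -/
private theorem apply_mem_krylov_succ {n : ℕ} {x : E} (hx : x ∈ krylov U e n) :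
    U x ∈ krylov U e (n + 1) := by
  have : (krylov U e n).map U ≤ krylov U e (n + 1) := by
    rw [krylov, map_span, span_le]
    rintro _ ⟨_, ⟨i, rfl⟩, rfl⟩
    rw [← Module.End.mul_apply, ← pow_succ']
    exact pow_apply_mem_krylov U e (Nat.succ_le_of_lt i.2)
  exact this (mem_map_of_mem hx)

/-- `U^l H_n ⊆ H_{n+l}`. [folklore] -/
private theorem pow_apply_mem_krylov_add {n : ℕ} {x : E} (hx : x ∈ krylov U e n) (l : ℕ) :
    (U ^ l) x ∈ krylov U e (n + l) := by
  induction l with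
  | zero => simpa using hx
  | succ l ih =>
    rw [pow_succ', Module.End.mul_apply, ← Nat.add_assoc]
    exact apply_mem_krylov_succ U e ih

/-- `β_k ∈ H_k`. [folklore] -/
private theorem newtonVec_mem_krylov_self (k : ℕ) : newtonVec U e r k ∈ krylov U e k := by
  induction k with
  | zero => exact pow_apply_mem_krylov U e (i := 0) le_rfl
  | succ k ih =>
    rw [newtonVec_succ]
    exact sub_mem (apply_mem_krylov_succ U e ih) (smul_mem _ _ (krylov_mono U e k.le_succ ih))

/-- `β_k ∈ H_n` for `k ≤ n`. [folklore] -/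
private theorem newtonVec_mem_krylov {k n : ℕ} (h : k ≤ n) : newtonVec U e r k ∈ krylov U e n :=
  krylov_mono U e h (newtonVec_mem_krylov_self U e r k)

/-- The span of the first `n+1` Newton vectors. [folklore] -/
def newtonSpan (n : ℕ) : Submodule 𝕜 E :=
  span 𝕜 (Set.range fun i : Fin (n + 1) => newtonVec U e r i)

/-- `β_k ∈ span {β_0, …, β_n}` for `k ≤ n`. [folklore] -/
private theorem newtonVec_mem_newtonSpan {k n : ℕ} (h : k ≤ n) :
    newtonVec U e r k ∈ newtonSpan U e r n :=
  subset_span ⟨⟨k, Nat.lt_succ_of_le h⟩, rfl⟩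

/-- Monotonicity of the Newton spans. [folklore] -/
private theorem newtonSpan_mono {m n : ℕ} (h : m ≤ n) : newtonSpan U e r m ≤ newtonSpan U e r n := by
  refine span_le.mpr ?_
  rintro _ ⟨i, rfl⟩
  exact newtonVec_mem_newtonSpan U e r (Nat.le_trans (Nat.le_of_lt_succ i.2) h)

/-- `U` maps `span {β_0, …, β_n}` into `span {β_0, …, β_{n+1}}` (`U β_k = β_{k+1} + r_k β_k`). [folklore] -/
private theorem apply_mem_newtonSpan_succ {n : ℕ} {x : E} (hx : x ∈ newtonSpan U e r n) :
    U x ∈ newtonSpan U e r (n + 1) := by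
  have : (newtonSpan U e r n).map U ≤ newtonSpan U e r (n + 1) := by
    rw [newtonSpan, map_span, span_le]
    rintro _ ⟨_, ⟨i, rfl⟩, rfl⟩
    rw [SetLike.mem_coe, apply_newtonVec]
    exact add_mem (newtonVec_mem_newtonSpan U e r (Nat.succ_le_of_lt i.2))
      (smul_mem _ _ (newtonVec_mem_newtonSpan U e r (Nat.le_of_lt_succ (Nat.lt_succ_of_lt i.2))))
  exact this (mem_map_of_mem hx)

/-- `U^k e ∈ span {β_0, …, β_k}` (the inverse triangular change). [folklore] -/
private theorem pow_apply_mem_newtonSpan_self (k : ℕ) : (U ^ k) e ∈ newtonSpan U e r k := by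
  induction k with
  | zero => simpa using newtonVec_mem_newtonSpan U e r (k := 0) (n := 0) le_rfl
  | succ k ih =>
    rw [pow_succ', Module.End.mul_apply]
    exact apply_mem_newtonSpan_succ U e r ih

/-- `U^k e ∈ span {β_0, …, β_n}` for `k ≤ n`. [folklore] -/
private theorem pow_apply_mem_newtonSpan {k n : ℕ} (h : k ≤ n) : (U ^ k) e ∈ newtonSpan U e r n :=
  newtonSpan_mono U e r h (pow_apply_mem_newtonSpan_self U e r k)

/-- `H_n = span {β_0, …, β_n}` (a triangular change of generators; in the model: `𝒫_n` is spanned by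
polynomials of exact degrees `0, …, n`, condition (a) of [Szego1939] §11.1 (2)).
[cite: Szego1939, §11.2 Thm 11.2, eq. (11.2.2)] -/
theorem krylov_eq_newtonSpan (n : ℕ) : krylov U e n = newtonSpan U e r n := by
  apply le_antisymm
  · refine span_le.mpr ?_
    rintro _ ⟨i, rfl⟩
    exact pow_apply_mem_newtonSpan U e r (Nat.le_of_lt_succ i.2)
  · refine span_le.mpr ?_
    rintro _ ⟨i, rfl⟩
    exact newtonVec_mem_krylov U e r (Nat.le_of_lt_succ i.2)

end basic

/-! ### The Bernstein–Szegő hypotheses -/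

/-- **Bernstein–Szegő data at the level of an abstract inner-product space.** `U` is a linear
operator on `E`, `e ∈ E` a cyclic-type vector whose orbit `e, U e, U² e, …` is linearly
independent, and `r : Fin σ → 𝕜` a list of `σ` scalars; put `ψ := ∏_{i<σ} (U - r_i) e`
(`= newtonVec U e r σ`, see `newtonVec_eq_aeval`). The hypothesis `orthogonal` says that
`U^j ψ ⊥ U^m e` whenever `m < j + σ`, i.e. `U^j ψ ⊥ H_{j+σ-1}` for every `j ≥ 0`.

In the model `E = L²(𝕋, f dθ/2π)`, `f = 1/|h|²` with `h` a polynomial of precise degree `σ`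
without zeros in the closed unit disc, `U = M_z`, `e = 1`, `r` = the zeros of the reversed
polynomial `h^*(z) = z^σ \overline{h(1/\bar z)}` (so that `ψ = h^*/\overline{h(0)}`), this is
exactly Szegő's theorem that `z^{j} h^*` is (a multiple of) the orthonormal polynomial of degree
`j + σ` [cite: Szego1939, Thm 11.2, eq. (11.2.2)]; the present structure isolates what that
theorem feeds into the finite-section computations below. -/
structure IsBernsteinSzego (U : E →ₗ[𝕜] E) (e : E) {σ : ℕ} (r : Fin σ → 𝕜) : Prop where
  /-- the orbit `k ↦ U^k e` is linearly independent (in the model: the monomials `z^k`). -/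
  linearIndependent : LinearIndependent 𝕜 fun k : ℕ => (U ^ k) e
  /-- Bernstein–Szegő orthogonality: `⟪U^j ψ, U^m e⟫ = 0` for `m < j + σ`. -/
  orthogonal : ∀ j m : ℕ, m < j + σ → ⟪(U ^ j) (newtonVec U e r σ), (U ^ m) e⟫_𝕜 = 0

section consequences

variable {U : E →ₗ[𝕜] E} {e : E} {σ : ℕ} {r : Fin σ → 𝕜}

/-- Above the threshold the Newton vectors leave `H_n` orthogonally:
`β_k ⊥ H_n` whenever `σ ≤ n + 1 ≤ k`. [cite: Szego1939, §11.2 Thm 11.2, eq. (11.2.2)] -/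
theorem IsBernsteinSzego.newtonVec_mem_orthogonal (h : IsBernsteinSzego U e r) {n k : ℕ}
    (hσ : σ ≤ n + 1) (hk : n + 1 ≤ k) : newtonVec U e r k ∈ (krylov U e n)ᗮ := by
  rw [newtonVec_eq_pow_apply U e r (Nat.le_trans hσ hk), mem_orthogonal]
  intro u hu
  induction hu using span_induction with
  | mem x hx =>
    obtain ⟨i, rfl⟩ := hx
    rw [inner_eq_zero_symm]
    exact h.orthogonal _ _ (by have := i.2; omega)
  | zero => exact inner_zero_left _
  | add x y _ _ hx hy => rw [inner_add_left, hx, hy, add_zero]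
  | smul a x _ hx => rw [inner_smul_left, hx, mul_zero]

/-- `dim H_n = n + 1`. (`dim 𝒫_n = n + 1`; in Connes' count `dim B_Λ = 2N + 1 + (2 - 2g)`.) [cite: Connes1999, §VIII Lemma 1 (eq. (12)) and Cor. 2] -/
theorem IsBernsteinSzego.finrank_krylov (h : IsBernsteinSzego U e r) (n : ℕ) :
    finrank 𝕜 (krylov U e n) = n + 1 := by
  have hli : LinearIndependent 𝕜 fun i : Fin (n + 1) => (U ^ (i : ℕ)) e :=
    h.linearIndependent.comp (fun i : Fin (n + 1) => (i : ℕ)) Fin.val_injective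
  rw [krylov, finrank_span_eq_card hli, Fintype.card_fin]

/-- The Newton vectors `β_0, …, β_n` as elements of `H_n`. [cite: Szego1939, §11.2 Thm 11.2, eq. (11.2.2)] -/
def newtonFamily (U : E →ₗ[𝕜] E) (e : E) (r : Fin σ → 𝕜) (n : ℕ) (i : Fin (n + 1)) :
    krylov U e n :=
  ⟨newtonVec U e r i, newtonVec_mem_krylov U e r (Nat.le_of_lt_succ i.2)⟩

/-- Underlying vector of `newtonFamily`. [folklore] -/
@[simp] private theorem coe_newtonFamily (n : ℕ) (i : Fin (n + 1)) :
    (newtonFamily U e r n i : E) = newtonVec U e r i := rfl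

/-- The Newton vectors `β_0, …, β_n` span `H_n`. [cite: Szego1939, §11.2 Thm 11.2, eq. (11.2.2)] -/
theorem span_newtonFamily (n : ℕ) :
    span 𝕜 (Set.range (newtonFamily U e r n)) = ⊤ := by
  apply map_injective_of_injective (krylov U e n).injective_subtype
  rw [map_span, map_subtype_top, ← Set.range_comp]
  exact (krylov_eq_newtonSpan U e r n).symm

/-- The Newton vectors `β_0, …, β_n` are linearly independent in `H_n` (`dim H_n = n + 1`). [cite: Szego1939, §11.2 Thm 11.2, eq. (11.2.2)] -/
theorem IsBernsteinSzego.linearIndependent_newtonFamily (h : IsBernsteinSzego U e r) (n : ℕ) :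
    LinearIndependent 𝕜 (newtonFamily U e r n) :=
  linearIndependent_of_top_le_span_of_card_eq_finrank (span_newtonFamily n).ge
    (by rw [h.finrank_krylov, Fintype.card_fin])

/-- The Newton basis `β_0, …, β_n` of `H_n`. [cite: Szego1939, §11.2 Thm 11.2, eq. (11.2.2)] -/
def IsBernsteinSzego.newtonBasis (h : IsBernsteinSzego U e r) (n : ℕ) :
    Basis (Fin (n + 1)) 𝕜 (krylov U e n) :=
  Basis.mk (h.linearIndependent_newtonFamily n) (span_newtonFamily n).ge

/-- The Newton basis is the Newton family. [cite: Szego1939, §11.2 Thm 11.2, eq. (11.2.2)] -/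
@[simp] theorem IsBernsteinSzego.coe_newtonBasis (h : IsBernsteinSzego U e r) (n : ℕ) :
    ⇑(h.newtonBasis n) = newtonFamily U e r n :=
  Basis.coe_mk _ _

end consequences

/-! ### The compressed shift `Q_n U^l Q_n` -/

/-- The compression `Q_n U^l |_{H_n}` of `U^l` to the Krylov space `H_n` (`Q_n` = orthogonal
projection onto `H_n`), as an endomorphism of `H_n`. In the census dictionary this is Connes'
`Q_Λ V(g_l) Q_Λ` restricted to `B_Λ`. [folklore] -/
def compShift (U : E →ₗ[𝕜] E) (e : E) (n l : ℕ) : krylov U e n →ₗ[𝕜] krylov U e n :=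
  ((krylov U e n).orthogonalProjectionOnto : E →ₗ[𝕜] krylov U e n) ∘ₗ (U ^ l) ∘ₗ
    (krylov U e n).subtype

section compressed

variable {U : E →ₗ[𝕜] E} {e : E} {σ : ℕ} {r : Fin σ → 𝕜}

/-- Unfolding of `compShift`: `x ↦ Q_n (U^l x)`. [folklore] -/
private theorem compShift_apply (n l : ℕ) (x : krylov U e n) :
    compShift U e n l x = (krylov U e n).orthogonalProjectionOnto ((U ^ l) x) := rfl

/-- `Q_n U^0 |_{H_n} = id`. [cite: Connes1999, §VIII Lemma 1 (eq. (12)) and Cor. 2] -/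
@[simp] theorem compShift_zero (n : ℕ) : compShift U e n 0 = LinearMap.id := by
  ext x
  simp [compShift_apply]

/-- Action of the compressed shift on the Newton basis: lower bidiagonal,
`Q_n U β_j = r_j β_j + β_{j+1}` for `j < n` and `Q_n U β_n = r_n β_n` (with `r_j = 0` for
`j ≥ σ`), provided `σ ≤ n + 1`. [cite: Szego1939, §11.2 Thm 11.2, eq. (11.2.2)] [cite: Szego1939, Thm 11.4.2, eq. (11.4.7)] -/
theorem IsBernsteinSzego.compShift_one_newtonFamily (h : IsBernsteinSzego U e r) {n : ℕ}
    (hσ : σ ≤ n + 1) (j : Fin (n + 1)) :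
    compShift U e n 1 (newtonFamily U e r n j) =
      rootSeq r j • newtonFamily U e r n j +
        if hj : (j : ℕ) + 1 ≤ n then newtonFamily U e r n ⟨j + 1, Nat.lt_succ_of_le hj⟩
        else 0 := by
  rw [compShift_apply, pow_one, coe_newtonFamily, apply_newtonVec, map_add, map_smul, add_comm]
  congr 1
  · rw [← coe_newtonFamily n j, orthogonalProjectionOnto_mem_subspace_eq_self]
  · split_ifs with hj
    · rw [← coe_newtonFamily n ⟨j + 1, Nat.lt_succ_of_le hj⟩,
        orthogonalProjectionOnto_mem_subspace_eq_self]
    · exact orthogonalProjectionOnto_apply_of_mem_orthogonal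
        (h.newtonVec_mem_orthogonal hσ (by omega))

/-- Matrix of `Q_n U|_{H_n}` in the Newton basis. [cite: Szego1939, §11.2 Thm 11.2, eq. (11.2.2)] -/
theorem IsBernsteinSzego.toMatrix_compShift_one (h : IsBernsteinSzego U e r) {n : ℕ}
    (hσ : σ ≤ n + 1) (i j : Fin (n + 1)) :
    LinearMap.toMatrix (h.newtonBasis n) (h.newtonBasis n) (compShift U e n 1) i j =
      (if i = j then rootSeq r j else 0) + (if (i : ℕ) = j + 1 then 1 else 0) := by
  rw [LinearMap.toMatrix_apply, h.coe_newtonBasis, h.compShift_one_newtonFamily hσ, map_add,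
    map_smul, Finsupp.add_apply, Finsupp.smul_apply]
  congr 1
  · rw [← h.coe_newtonBasis, Basis.repr_self, Finsupp.single_apply, smul_eq_mul]
    split_ifs with h1 h2 h2
    · rw [mul_one]
    · exact absurd h1.symm h2
    · exact absurd h2.symm h1
    · rw [mul_zero]
  · split_ifs with hj h1 h1
    · rw [← h.coe_newtonBasis, Basis.repr_self, Finsupp.single_apply, if_pos (Fin.ext h1.symm)]
    · rw [← h.coe_newtonBasis, Basis.repr_self, Finsupp.single_apply, if_neg]
      intro hji
      exact h1 (by rw [← hji])
    · exact absurd (h1 ▸ i.2 : (j : ℕ) + 1 < n + 1) (by omega)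
    · rw [map_zero, Finsupp.zero_apply]

end compressed

/-! ### Powers of a lower-triangular matrix -/

/-- For a lower-triangular square matrix `M` (entries above the diagonal vanish), every power
`M ^ l` is lower triangular and its diagonal is the entrywise `l`-th power of the diagonal of `M`.
[folklore] -/
private theorem pow_apply_of_lowerTriangular {R : Type*} [CommRing R] {m : ℕ} (M : Matrix (Fin m) (Fin m) R)
    (hM : ∀ i j, i < j → M i j = 0) (l : ℕ) :
    (∀ i j, i < j → (M ^ l) i j = 0) ∧ ∀ i, (M ^ l) i i = M i i ^ l := by
  induction l with
  | zero =>
    refine ⟨fun i j hij => ?_, fun i => ?_⟩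
    · rw [pow_zero, Matrix.one_apply_ne (ne_of_lt hij)]
    · rw [pow_zero, pow_zero, Matrix.one_apply_eq]
  | succ l ih =>
    obtain ⟨ih1, ih2⟩ := ih
    refine ⟨fun i j hij => ?_, fun i => ?_⟩
    · rw [pow_succ, Matrix.mul_apply]
      refine Finset.sum_eq_zero fun k _ => ?_
      by_cases hk : i < k
      · rw [ih1 i k hk, zero_mul]
      · rw [hM k j (lt_of_le_of_lt (not_lt.mp hk) hij), mul_zero]
    · rw [pow_succ, Matrix.mul_apply, Finset.sum_eq_single i, ih2, pow_succ]
      · intro k _ hki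
        rcases lt_or_gt_of_ne hki with hk | hk
        · rw [hM k i hk, mul_zero]
        · rw [ih1 i k hk, zero_mul]
      · exact fun hi => absurd (Finset.mem_univ i) hi

/-- Trace of a power of a lower-triangular matrix = power sum of its diagonal. [folklore] -/
private theorem trace_pow_of_lowerTriangular {R : Type*} [CommRing R] {m : ℕ}
    (M : Matrix (Fin m) (Fin m) R) (hM : ∀ i j, i < j → M i j = 0) (l : ℕ) :
    (M ^ l).trace = ∑ i, M i i ^ l := by
  simp only [Matrix.trace, Matrix.diag_apply, (pow_apply_of_lowerTriangular M hM l).2]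

section main

variable {U : E →ₗ[𝕜] E} {e : E} {σ : ℕ} {r : Fin σ → 𝕜}

/-- `∑_{j ≤ n} (rootSeq r j)^l = ∑_{i<σ} r_i^l` for `l ≥ 1` and `σ ≤ n + 1`. [folklore] -/
private theorem sum_rootSeq_pow {n l : ℕ} (hσ : σ ≤ n + 1) (hl : 1 ≤ l) :
    ∑ j : Fin (n + 1), rootSeq r j ^ l = ∑ i : Fin σ, r i ^ l := by
  have h2 : ∑ j ∈ Finset.Ico σ (n + 1), rootSeq r j ^ l = 0 := Finset.sum_eq_zero fun j hj => by
    rw [rootSeq_of_le r (Finset.mem_Ico.mp hj).1, zero_pow (by omega)]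
  rw [Fin.sum_univ_eq_sum_range (fun j => rootSeq r j ^ l) (n + 1),
    ← Finset.sum_range_add_sum_Ico _ hσ, h2, add_zero,
    ← Fin.sum_univ_eq_sum_range (fun j => rootSeq r j ^ l) σ]
  exact Finset.sum_congr rfl fun i _ => by rw [rootSeq_of_lt r i.2]

/-- **Trace of the powers of the compressed shift (Bernstein–Szegő mechanism).** Under the
Bernstein–Szegő hypotheses, for every level `n` with `σ ≤ n + 1` (= "`dim H_n ≥ σ`") and every
`l ≥ 1`, `Tr((Q_n U Q_n)^l) = ∑_{i<σ} r_i^l` — independent of the level `n`. In the OPUC model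
this is the finite-section trace computation behind Szegő's Bernstein–Szegő formula
[cite: Szego1939, Thm 11.2]; see the module docstring for the census reading (Connes' char-`p`
semilocal trace formula at finite cutoff). -/
theorem IsBernsteinSzego.trace_compShift_one_pow (h : IsBernsteinSzego U e r) {n : ℕ}
    (hσ : σ ≤ n + 1) {l : ℕ} (hl : 1 ≤ l) :
    LinearMap.trace 𝕜 _ (compShift U e n 1 ^ l) = ∑ i : Fin σ, r i ^ l := by
  rw [LinearMap.trace_eq_matrix_trace 𝕜 (h.newtonBasis n), ← LinearMap.toMatrix_pow,
    trace_pow_of_lowerTriangular _ ?_ l]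
  · rw [← sum_rootSeq_pow hσ hl]
    refine Finset.sum_congr rfl fun i _ => ?_
    rw [h.toMatrix_compShift_one hσ, if_pos rfl, if_neg (by omega), add_zero]
  · intro i j hij
    rw [h.toMatrix_compShift_one hσ, if_neg (ne_of_lt hij), if_neg, add_zero]
    have : (i : ℕ) < j := hij
    omega

/-- `Tr(Q_n) = dim H_n = n + 1` (the identity component of the trace distribution). [cite: Connes1999, §VIII Lemma 1 (eq. (12)) and Cor. 2] -/
theorem IsBernsteinSzego.trace_compShift_zero (h : IsBernsteinSzego U e r) (n : ℕ) :
    LinearMap.trace 𝕜 _ (compShift U e n 0) = (n + 1 : ℕ) := by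
  rw [compShift_zero, LinearMap.trace_id, h.finrank_krylov]

/-! ### The power identity `(Q_n U Q_n)^l = Q_n U^l Q_n` -/

/-- For `y ∈ H_m` (any `m`; `σ ≤ n + 1`): `Q_n U (y - Q_n y) = 0`, i.e. `U` maps
`H_m ⊖ H_n = span {β_{n+1}, …, β_m}` into `H_n^⊥`. [cite: Szego1939, Thm 11.4.2, eq. (11.4.7)] -/
theorem IsBernsteinSzego.orthogonalProjectionOnto_apply_sub_starProjection
    (h : IsBernsteinSzego U e r) {n m : ℕ} (hσ : σ ≤ n + 1) {y : E}
    (hy : y ∈ krylov U e m) :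
    (krylov U e n).orthogonalProjectionOnto (U (y - (krylov U e n).starProjection y)) = 0 := by
  let K := krylov U e n
  let g : E →ₗ[𝕜] K := (K.orthogonalProjectionOnto : E →ₗ[𝕜] K) ∘ₗ U ∘ₗ
    (LinearMap.id - (K.starProjection : E →ₗ[𝕜] E))
  change g y = 0
  have hle : krylov U e m ≤ LinearMap.ker g := by
    rw [krylov_eq_newtonSpan U e r m, newtonSpan, span_le]
    rintro _ ⟨k, rfl⟩
    change g (newtonVec U e r k) = 0
    simp only [g, LinearMap.comp_apply, LinearMap.sub_apply, LinearMap.id_apply,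
      ContinuousLinearMap.coe_coe]
    by_cases hk : (k : ℕ) ≤ n
    · rw [starProjection_eq_self_iff.mpr (newtonVec_mem_krylov U e r hk), sub_self, map_zero,
        map_zero]
    · have hk' : n + 1 ≤ (k : ℕ) := by omega
      rw [(starProjection_apply_eq_zero_iff K).mpr (h.newtonVec_mem_orthogonal hσ hk'), sub_zero,
        apply_newtonVec]
      exact orthogonalProjectionOnto_apply_of_mem_orthogonal
        (add_mem (h.newtonVec_mem_orthogonal hσ (by omega))
          (smul_mem _ _ (h.newtonVec_mem_orthogonal hσ hk')))
  exact hle hy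

/-- `Q_n U^{l+1} Q_n = (Q_n U Q_n) ∘ (Q_n U^l Q_n)` above the threshold. [cite: Szego1939, Thm 11.4.2, eq. (11.4.7)] -/
theorem IsBernsteinSzego.compShift_succ (h : IsBernsteinSzego U e r) {n : ℕ} (hσ : σ ≤ n + 1)
    (l : ℕ) : compShift U e n (l + 1) = compShift U e n 1 ∘ₗ compShift U e n l := by
  refine LinearMap.ext fun x => ?_
  have hy : (U ^ l) (x : E) ∈ krylov U e (n + l) := pow_apply_mem_krylov_add U e x.2 l
  have h0 := h.orthogonalProjectionOnto_apply_sub_starProjection hσ hy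
  rw [map_sub, map_sub, sub_eq_zero] at h0
  rw [LinearMap.comp_apply, compShift_apply, compShift_apply, compShift_apply, pow_succ',
    Module.End.mul_apply, pow_one, coe_orthogonalProjectionOnto_apply]
  exact h0

/-- **The power identity** `(Q_n U Q_n)^l = Q_n U^l Q_n` for `σ ≤ n + 1`. [cite: Szego1939, Thm 11.4.2, eq. (11.4.7)] -/
theorem IsBernsteinSzego.compShift_one_pow (h : IsBernsteinSzego U e r) {n : ℕ} (hσ : σ ≤ n + 1)
    (l : ℕ) : compShift U e n 1 ^ l = compShift U e n l := by
  induction l with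
  | zero => rw [pow_zero, compShift_zero, Module.End.one_eq_id]
  | succ l ih => rw [pow_succ', ih, h.compShift_succ hσ l, Module.End.mul_eq_comp]

/-- **Exact finite-section trace formula.** For `σ ≤ n + 1` and `l ≥ 1`:
`Tr(Q_n U^l Q_n) = ∑_{i<σ} r_i^l`, the `l`-th power sum of the prescribed roots, independent
of `n`. [cite: Szego1939, §11.2 Thm 11.2, eq. (11.2.2)] [cite: Connes1999, §VIII Lemma 1 (eq. (12)) and Cor. 2] -/
theorem IsBernsteinSzego.trace_compShift (h : IsBernsteinSzego U e r) {n : ℕ} (hσ : σ ≤ n + 1)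
    {l : ℕ} (hl : 1 ≤ l) :
    LinearMap.trace 𝕜 _ (compShift U e n l) = ∑ i : Fin σ, r i ^ l := by
  rw [← h.compShift_one_pow hσ, h.trace_compShift_one_pow hσ hl]

/-- Level independence: the traces at any two levels above the threshold agree. [cite: Connes1999, §VIII Lemma 1 (eq. (12)) and Cor. 2] -/
theorem IsBernsteinSzego.trace_compShift_eq (h : IsBernsteinSzego U e r) {n n' : ℕ}
    (hσ : σ ≤ n + 1) (hσ' : σ ≤ n' + 1) {l : ℕ} (hl : 1 ≤ l) :
    LinearMap.trace 𝕜 _ (compShift U e n l) = LinearMap.trace 𝕜 _ (compShift U e n' l) := by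
  rw [h.trace_compShift hσ hl, h.trace_compShift hσ' hl]

end main

/-! ### The function-field evaluation: roots `ζ q^{-1/2}` and the values `q^{-l/2} ∑_{d_v ∣ l} d_v`

For Connes' semilocal cutoff system on `k = 𝔽_q(T)` (Selecta Math. 5 (1999) §VIII) the weight is
`|ζ_S(½ + it)|² = 1/|p_S(e^{iθ})|²`, `p_S(z) = ∏_{v ∈ S} (1 - (z/√q)^{d_v})`, so the prescribed roots
are those of the reversed polynomial `p_S^*(z) = ∏_v (z^{d_v} - q^{-d_v/2})`, namely `ζ · q^{-1/2}`
with `ζ^{d_v} = 1`. Their power sums are the S-truncated explicit-formula values. -/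

section arithmetic

open Complex in
/-- Power sums over the scaled `d`-th roots of unity:
`∑_{j<d} (ζ_d^j c)^l = d c^l` if `d ∣ l` and `0` otherwise (`ζ_d = e^{2πi/d}`). [cite: Connes1999, §VIII eq. (10)–(12)] -/
theorem sum_pow_rootOfUnity_mul {d : ℕ} (hd : 0 < d) (c : ℂ) (l : ℕ) :
    ∑ j ∈ Finset.range d, (exp (2 * Real.pi * I / d) ^ j * c) ^ l =
      if d ∣ l then (d : ℂ) * c ^ l else 0 := by
  have hζ := Complex.isPrimitiveRoot_exp d hd.ne'
  set ζ := exp (2 * Real.pi * I / d)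
  have hrw : ∀ j ∈ Finset.range d, (ζ ^ j * c) ^ l = (ζ ^ l) ^ j * c ^ l := fun j _ => by ring
  rw [Finset.sum_congr rfl hrw, ← Finset.sum_mul]
  split_ifs with hdl
  · rw [(hζ.pow_eq_one_iff_dvd l).mpr hdl]
    simp
  · have hne : ζ ^ l ≠ 1 := fun h1 => hdl ((hζ.pow_eq_one_iff_dvd l).mp h1)
    rw [geom_sum_eq hne, ← pow_mul, mul_comm l d, pow_mul, hζ.pow_eq_one, one_pow, sub_self,
      zero_div, zero_mul]

open Complex in
/-- `X^d - c^d = ∏_{j<d} (X - ζ_d^j c)` over `ℂ`. [cite: Connes1999, §VIII Lemma 1] -/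
theorem X_pow_sub_C_pow_eq_prod {d : ℕ} (hd : 0 < d) (c : ℂ) :
    (X ^ d - C (c ^ d) : ℂ[X]) =
      ∏ j ∈ Finset.range d, (X - C (exp (2 * Real.pi * I / d) ^ j * c)) :=
  _root_.X_pow_sub_C_eq_prod (Complex.isPrimitiveRoot_exp d hd.ne') hd rfl

open Complex in
/-- **The S-truncated explicit-formula values as power sums.** For a finite family of places
with degrees `d v ≥ 1` and a scalar `c` (in the census: `c = q^{-1/2}`), the `l`-th power sum of
the roots `ζ_{d_v}^j c` (`v ∈ S`, `j < d_v`) of `∏_v (X^{d_v} - c^{d_v})` equals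
`c^l · ∑_{v : d_v ∣ l} d_v` — Connes' values `q^{-|l|/2} ∑_{v ∈ S, d_v ∣ l} d_v` of
`Tr(Q_Λ V(g_l))` [cite: Connes1999, §VIII, Lemma 1 and Cor. 2]. -/
theorem sum_sum_pow_roots_eq {ι : Type*} (S : Finset ι) (d : ι → ℕ) (hd : ∀ v ∈ S, 0 < d v)
    (c : ℂ) (l : ℕ) :
    ∑ v ∈ S, ∑ j ∈ Finset.range (d v), (exp (2 * Real.pi * I / (d v)) ^ j * c) ^ l =
      c ^ l * ∑ v ∈ S with d v ∣ l, (d v : ℂ) := by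
  rw [Finset.sum_filter, Finset.mul_sum]
  refine Finset.sum_congr rfl fun v hv => ?_
  rw [sum_pow_rootOfUnity_mul (hd v hv)]
  split_ifs <;> ring

open Complex in
/-- The polynomial whose roots are prescribed: `∏_{v∈S} (X^{d_v} - c^{d_v}) =
∏_{v∈S} ∏_{j<d_v} (X - ζ_{d_v}^j c)` (for `c = q^{-1/2}` this is `p_S^*`). [cite: Connes1999, §VIII Lemma 1] -/
theorem prod_X_pow_sub_C_pow_eq_prod_prod {ι : Type*} (S : Finset ι) (d : ι → ℕ)
    (hd : ∀ v ∈ S, 0 < d v) (c : ℂ) :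
    ∏ v ∈ S, (X ^ d v - C (c ^ d v) : ℂ[X]) =
      ∏ v ∈ S, ∏ j ∈ Finset.range (d v), (X - C (exp (2 * Real.pi * I / (d v)) ^ j * c)) :=
  Finset.prod_congr rfl fun v hv => X_pow_sub_C_pow_eq_prod (hd v hv) c

end arithmetic

end BernsteinSzego

end Literature.Analysis.Toeplitz
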